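import Summits.QuantumFields.YangMills.Theorems.BalabanUVNodesN08AtRecord13CoPLaneFamily
import Summits.QuantumFields.YangMills.Theorems.BalabanUVNodesN08AtRecord13LaneProfile

/-!
# v1.5 `CoP` EDITION — director-ym LINE №160 ∕ №162 ((y) FINAL, EDITION FREEZE): RECORD 13 re-seeded at print's COLLAR-ranged background class (node00-def-R FILE 22′
# `LargeFieldBackgroundCoPOfRecord`, `UbgMSCoPOfRecord`) and the collar-exempt 𝐓-weights (def-T 12a″); def-T FILE 23 `Node00/Record13CoP` (p520810) + 24T `Node00/Record13SepCoP`
# (p521293), token tables KEY-23 ∕ KEY-24T = «the v1.4 names with `Co ↦ CoP`» (`toStage5₁₃CoP`, `datumOfRecord₁₃CoP`, `IsRecordOfRecord₁₃CCoP`, `Provisos₁₃SepCoP`, `datumOfRecord₁₃SepCoP`,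
# `IsRecordOfRecord₁₃CSepCoP(.toCoP)`; `Provisos₁₃Core` token-identical), dag-n10-d's CoP carrier leaves `Node00/Record13CarriersCoP ∕ Record13CarriersSepCoP` (`toStage5₁₃CoP_pin<G> ∕ _rebindX`,
# `view₁₃CoPB10YZW(_eq)`, `datumOfRecord₁₃(Sep)CoP_pin<G>`, `isRecordOfRecord₁₃C(Sep)CoP_pinB10_of_eq ∕ _rebindX_of_eq`, `exists_world_isRecordOfRecord₁₃CCoP_rebindX`).  THIS FILE is the verbatim token
# image (of `BalabanUVNodesN08AtRecord13CoLaneProfile` (p521213)) under that table (generator `tools/cop_n08_gen.py`); statement SHAPES and proofs identical up to the tokens; the source module stays as the v1.4 sibling.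
#
# BalabanUVNodes ∕ N08 AT THE LANE-RE-BOUND STAGE-13 RECORD FROM REGULAR `h`-LARGE PROFILES (b11‴), AT PRINT'S BACKGROUND — the CoP ∕ Core re-key (KEY-RULE-21) of
# `BalabanUVNodesN08AtRecord13LaneProfile` (p498647): dag-n08-d's packaged (α) END forms (`BalabanUVNodesN08AlphaProfile`) composed BY NAME into this seat's CoP lane storey
# `BalabanUVNodesN08AtRecord13CoPLaneFamily` (Track A, DAG node N08 [Balaban1985UV3] CMP **102** (1985) 255, Thm 1 p. 257 (compact reading) + Thm 2 p. 272; R134 fan-out seat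
# `pub-ymgap-dag-n08-c` g15, strategy s2 «knit at the record of record», trigger (t19‴) = def-T KEY-21C → KEY-23; dag-lead ORPHAN-STOREYS row A1 (file 4 of 5), 2026-08-27)

WHY THIS FILE.  p498647 keys on `Provisos₁₃ ∕ datumOfRecord₁₃ ∕ IsRecordOfRecord₁₃C` and binds its worlds over `(θ.rebindX …).toStage5₁₃` (U_old); under director-ym LINE №152
RULING (β) the record of RECORD 13 is re-based ONCE at print's background (def-T FILE 23 `Node00/Record13CoP`, dag-n10-d's `Node00/Record13CarriersCoP`), so its §2 ∕ §2b ∕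
§3 ∕ §4 theorems are re-typed here as IMAGES under KEY-RULE-21 (`IsRecordOfRecord₁₃C ↦ IsRecordOfRecord₁₃CCoP`, `(h : Provisos₁₃) ↦ (h : Provisos₁₃Core)`, `datumOfRecord₁₃ ↦
datumOfRecord₁₃CoP`, `toStage5₁₃ ↦ toStage5₁₃CoP`) over `…CoLaneFamily` §2 ∕ §2b ∕ §3.  CITED, not re-declared (record-free ∕ background-free; dag-lead DEDUP-113): p498647 §1's
selections `N08AtRecord13LaneProfile.exists_inputs_faces₃_family_of_profile ∕ exists_inputs_runAlpha_family_of_profile_std` (external inputs with the three in-edge faces, resp.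
with `RunAlpha` from DATA, uniformly in `S : Scales L`, from regular `h`-large profiles (b11‴) — dag-n08-d's `exists_externalInputs_faces₃ ∕ _runAlpha_of_profile` under the
axiom of choice) and §3's `b10Compact_laneFamily_of_runAlpha`; p495845's `b10Compact_laneFamily_of_data_faces₃ ∕ nonempty_laneIndex`.  The makers `theta13LiveOfNumerics …`
and K0a's faces are θ-level and background-free, so §4 serves at the Core key with provisos OPAQUE (`hP : θL.Provisos₁₃Core F 2`).

THE SHAPE OF THE CONCLUSIONS (as in p498647).  The selected inputs are EXISTENTIAL (measurable minimisers chosen inside dag-n08-d's proof), so every END theorem reads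
`∃ X : ∀ S, ExternalInputs S G, (agreement with X₀ on av ∕ reg) ∧ (on the N08 window: measurability ∧ InEdgeFaces₃) ∧ ∀ 𝔖 𝔄 coef, DATA(X) → …` — DATA is demanded AT THE
SELECTED INPUTS inside the ∃; a consumer discharges it only by a supplier uniform in `X.UkH` ((41)∕(47) = dag-n08-b's class II object gap, unchanged).

WHAT THIS FILE PROVES (0 `def`, 0 `sorry`; kernel bookkeeping BY NAME).
* §2 ★ `exists_world₁₃CCoP_laneFamily_b10_main_of_profile` (pointed: a ₁₃CCoP record of `datumOfRecord₁₃CoP θ h` bound over the lane-re-bound CoP view at the selected inputs, any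
  window `γw`, carrying N08 at every run), ★ `exists_guarded_record₁₃CCoP_laneFamily_b10_main_of_profile` (N08's conjunct shape of a Core-keyed `NodesAtSomeRecord13`, AT `θ`);
  §2b ★ `exists_inputs_b10_main_pin3_of_profile` (provisos-free pointed closer over the lane-keyed four-layer CoP word `((((θ.rebindX …).pinY Y₀).pinZ Z₀).pinW W₀).toStage5₁₃CoP`).
* §3 standard averaging: `exists_world₁₃CCoP_laneFamily_b10_main_of_runAlpha`, `exists_guarded_record₁₃CCoP_laneFamily_b10_main_of_runAlpha`, ★ `exists_world₁₃CCoP_laneFamily_b10_main_of_profile_std`,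
  ★ `exists_guarded_record₁₃CCoP_laneFamily_b10_main_of_profile_std`.
* §4 on K0a's all-numerics family at `N = 2`, block size `F.L`, Core provisos opaque, guard = K0a's HYPOTHESIS-FREE row P12:
  ★★ `exists_guarded_record₁₃CCoP_laneFamily_b10_main_at_theta13LiveOfNumerics_of_data_faces₃ ∕ _of_profile ∕ _of_profile_std`.
HONEST FRAMING — PLEASE READ.  The re-bound [B10] layer is the LANE's constructed family along the selected inputs (the lane's averaging class with its exact Haar compatibility
field), NOT print's run family of record along `avOfPrint` — NOT an inhabitant of the slot of record `PrintedUV3V`, NOT a re-pointing of S1; whether N08's COUNT may be read there is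
the chair's species word (seam E6′, R451 ∕ R454).  Count-neutral re-keying of a LANDED storey to the corrected record (new file; p498647 stays as the pre-№152 sibling); NOT A
DISCHARGE OF N08; nothing of Bałaban's asserted — (b11‴), the kinematic choices, the cluster-expansion DATA schema at the selected inputs, the Core provisos, the guard and the
signs are DISPLAYED hypotheses; the selected inputs are existential; one finite four-torus per run at fixed `ε`, the lane's d = 3 tori inside the record; nothing continuum ∕ ℝ⁴ ∕
OS ∕ mass gap ∕ Clay.
Sources: [Balaban1985UV3] Thm 1 p.257 (compact reading), Thm 2 p.272, (41)–(42) p.266, (67)–(68) p.273, p.256 L15–18; [Balaban1985Variational] Thm 1, (2)+(3)+(8) pp.278–279;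
[Balaban1989LargeFieldII] Thm 1 + (0.1) pp.355–356; [Balaban1988Convergent] (2.18) p.257, (3.16)–(3.22) pp.268–269; [Balaban1987RG1] (0.1) p.251, Thm 1 p.255.
-/

noncomputable section

namespace Summit.QuantumFields.YangMills.BalabanUVNodes.N08AtRecord13CoPLaneProfile

open MeasureTheory Set Topology TopologicalSpace
open scoped Matrix Matrix.Norms.L2Operator
open Literature.MathematicalPhysics.QuantumFieldTheory.Balaban1983to89
open Literature.MathematicalPhysics.QuantumFieldTheory.Balaban1983to89.B10
open Literature.MathematicalPhysics.QuantumFieldTheory.Balaban1983to89.B10SectCExpansion (TermSizes)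
open Literature.MathematicalPhysics.QuantumFieldTheory.Balaban1985CMP102
open Literature.MathematicalPhysics.QuantumFieldTheory.Balaban1985CMP102.Setting
open Literature.MathematicalPhysics.QuantumFieldTheory.Balaban1983to89.T4Continuum (T4Family)
open Literature.MathematicalPhysics.QuantumFieldTheory.Balaban1983to89.DagBinding (leavesP WorldP PrintedCarriersR PrintedCarriers9X PrintedCarriers11 PrintedCarriers15)
open Literature.MathematicalPhysics.QuantumFieldTheory.Balaban1983to89.DagDischarged (b10Compact)
open Literature.MathematicalPhysics.QuantumFieldTheory.Balaban1983to89.Node00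
open Summit.QuantumFields.Balaban3D.Carriers
open Summit.QuantumFields.Balaban3D.Proofs.Inputs
open Summit.QuantumFields.Balaban3D.Proofs.Primitives (AlphaConsts)
open Summit.QuantumFields.Balaban3D.Proofs.GroupModelLieC (lieC)
open Summit.QuantumFields.Balaban3D.Proofs.UVStability3DInputs
open Summit.QuantumFields.Balaban3D.Proofs.FamilyLE (ScalesLE)
open Summit.QuantumFields.Balaban3D.Proofs.LiftBridge (liftCfg)
open Summit.QuantumFields.YangMills.Theorems.BalabanUVNodesN08AlphaClassI
open Summit.QuantumFields.YangMills.Theorems.BalabanUVNodesN08AlphaLoop28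
open Summit.QuantumFields.YangMills.Theorems.BalabanUVNodesN08AlphaThreeFaces
open Summit.QuantumFields.YangMills.Theorems.BalabanUVNodesN08AlphaGroupTopology
open Summit.QuantumFields.YangMills.Theorems.BalabanUVNodesN08AlphaRegSel
open Summit.QuantumFields.YangMills.Theorems.BalabanUVNodesN08AlphaCompactSel
open Summit.QuantumFields.YangMills.Theorems.BalabanUVNodesN08AlphaArgClass
open Summit.QuantumFields.YangMills.Theorems.BalabanUVNodesN08AlphaProfile
open Summit.QuantumFields.YangMills.BalabanUVNodes.N08AtRecord13CoPLaneFamily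
open B7Prop2Explicit (avgIter)

variable {F : T4Family} {N : ℕ} [NeZero N]
variable {G : Type} [GaugeGroup G] [MeasurableSpace G] [HaarData G]

/-! ## §2 N08 AT THE LANE-RE-BOUND ₁₃CCoP RECORD FROM PROFILES (b11‴) + DATA AT THE SELECTED INPUTS — objective and top maps free (`θ` generic, block size `θ.L`) -/

section Profile
variable {𝔊 : GroupModel G} (θ : Stage13Params F N) (h : θ.Provisos₁₃Core F N) (hθ : θ.Admissible F N) {𝔠 : AlphaConsts θ.L 𝔊.N}
  (X₀ : ∀ S : Scales θ.L, ExternalInputs S G) {A : ∀ S : Scales θ.L, GaugeField S.P 0 G → ℝ}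
  (hA : letI := rhoTopology 𝔊; ∀ S : Scales θ.L, Continuous (A S)) (W : ∀ (S : Scales θ.L) (k : ℕ), Hist S.P k → GaugeField S.P 0 G)
  (hW : ∀ S : Scales θ.L, S.g ^ 2 * S.ε₀ ≤ (min (gammaN08 𝔠) 1) ^ 2 → ∀ k, k ≤ S.K → ∀ (h : Hist S.P k),
    Hist.Admissible (regMin 𝔠).lane.carrier.M₁ (rcolOf S (regMin 𝔠).lane.carrier) k h → W S k h ∈ regClassC 𝔊 (regMin 𝔠) k h ∩ argClassC 𝔊 k)
  (hWL : ∀ S : Scales θ.L, S.g ^ 2 * S.ε₀ ≤ (min (gammaN08 𝔠) 1) ^ 2 → ∀ (k : ℕ) (h : Hist S.P k),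
    HLarge S (regMin 𝔠).lane.carrier.b₀ (regMin 𝔠).lane.carrier.p₀ h (fun j => avgIter θ.L (liftCfg 𝔊 (W S k h)) j))
  (T : ∀ (S : Scales θ.L) (k : ℕ), GaugeField S.P 0 G → GaugeField S.P k G) (Bk : ∀ (S : Scales θ.L) (k : ℕ), Hist S.P k → Set (PBond S.P k))
  (hT : letI := rhoTopology 𝔊; ∀ (S : Scales θ.L) (k : ℕ) (h : Hist S.P k), ContinuousOn (T S k) (regClass 𝔊 (regMin 𝔠) k h))

include h hθ hA hW hWL Bk hT

/-- **★ POINTED: A ₁₃CCoP RECORD OF `datumOfRecord₁₃CoP F N θ h` BOUND OVER THE LANE-RE-BOUND STAGE-13 VIEW AT THE SELECTED INPUTS, CARRYING N08 AT EVERY RUN, from profiles (b11‴)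
and the DATA schema at the selected inputs** (any window `γw`, block size `θ.L`): external inputs `X` (agreeing with `X₀` on `av ∕ reg`; on the N08 window measurable, with the
three in-edge faces) EXIST such that, for every `𝔖 ∕ 𝔄 ∕ coef` with the DATA schema on the window, some world IS such a record, bound over
`(θ.rebindX (P ↦ (θ.res.X P).withTowerRuns10 (S ↦ towerOf 𝔠.lane (X S) (𝔖 S)))).toStage5₁₃CoP`, with `Dag.B10_main (leavesP w P)` at every run
(`…LaneFamily.exists_world₁₃CCoP_laneFamily_b10_main_of_data_faces₃`, face hypothesis DISCHARGED by dag-n08-d's chain). [cite: Balaban1985UV3, Thm 1 p.257 (compact reading) + Thm 2 p.272 + (42) p.266; Balaban1985Variational, Thm 1 (8) p.279; Balaban1989LargeFieldII, Thm 1 + (0.1) pp.355–356 (bookkeeping)] -/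
theorem exists_world₁₃CCoP_laneFamily_b10_main_of_profile {γw : ℝ} (hγw : 0 < γw ∧ γw ≤ θ.γ) :
    ∃ X : ∀ S : Scales θ.L, ExternalInputs S G,
      (∀ S : Scales θ.L, (X S).av = (X₀ S).av ∧ (X S).reg = (X₀ S).reg ∧
        (S.g ^ 2 * S.ε₀ ≤ (min (gammaN08 𝔠) 1) ^ 2 → (∀ (k : ℕ) (h : Hist S.P k), Measurable ((X S).UkH k h)) ∧ InEdgeFaces₃ 𝔊 (regMin 𝔠) (X S))) ∧
      ∀ (𝔖 : ∀ (S : Scales θ.L) (k : ℕ), StepSeries S G ↥(lieC 𝔊) (nblkOf S 𝔠.lane.carrier k) k) (𝔄 : ∀ S : Scales θ.L, AlphaData 𝔊 𝔠 (X S) (𝔖 S))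
        (coef : ∀ (S : Scales θ.L) (k : ℕ), Hist S.P (k + 1) → GaugeField S.P (k + 1) G → (j : ℕ) → TermSizes (oldGeom S.P k j)),
        (∀ S : Scales θ.L, S.g ^ 2 * S.ε₀ ≤ (min (gammaN08 𝔠) 1) ^ 2 → RunDataRows 𝔊 𝔠 (X S) (𝔖 S) (𝔄 S) (sizesOf 𝔊 𝔠 (X S) (coef S))) →
        ∃ w : WorldP, IsRecordOfRecord₁₃CCoP F N (datumOfRecord₁₃CoP F N θ h) w ∧ w.γ = γw ∧ w.L = (θ.L : ℝ) ∧
          (∀ P, w.up P = upOfRecord₅C F N ((θ.rebindX F N fun P => (θ.res.X P).withTowerRuns10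
            fun S : ScalesLE θ.L ((min (gammaN08 𝔠) 1) ^ 2) => towerOf 𝔠.lane (X S.1) (𝔖 S.1)).toStage5₁₃CoP F N) P) ∧
          ∀ P : B12.RunParams, Dag.B10_main (leavesP w P) := by
  obtain ⟨X, hX⟩ := N08AtRecord13LaneProfile.exists_inputs_faces₃_family_of_profile 𝔊 𝔠 X₀ hA W hW hWL T Bk hT
  exact ⟨X, hX, fun 𝔖 𝔄 coef hD =>
    exists_world₁₃CCoP_laneFamily_b10_main_of_data_faces₃ θ h hθ (𝔄 := 𝔄) coef hD (fun S hS => ((hX S).2.2 hS).2) hγw⟩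

/-- **★ N08's CONJUNCT SHAPE OF A CORE-KEYED `NodesAtSomeRecord13`, WITNESSED AT `θ`, from profiles (b11‴) and the DATA schema at the selected inputs** (plus `θ`'s provisos,
admissibility and guard; block size `θ.L`): external inputs `X` as in §1 EXIST such that for every `𝔖 ∕ 𝔄 ∕ coef` with the DATA schema on the N08 window,
`∃ θ' h' w, guard ∧ Admissible ∧ IsRecordOfRecord₁₃CCoP F N (datumOfRecord₁₃CoP F N θ' h') w ∧ ∀ P, Dag.B10_main (leavesP w P)` (`…LaneFamily.exists_guarded_record₁₃CCoP_laneFamily_b10_main_of_data_faces₃`,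
face hypothesis DISCHARGED). [cite: Balaban1985UV3, Thm 1 p.257 (compact reading) + Thm 2 p.272 + (42) p.266; Balaban1985Variational, Thm 1 (8) p.279; Balaban1989LargeFieldII, Thm 1 + (0.1) pp.355–356; Balaban1988Convergent, (3.16)–(3.22) pp.268–269 (bookkeeping)] -/
theorem exists_guarded_record₁₃CCoP_laneFamily_b10_main_of_profile (hG : θ.ZtUnity F N ∧ θ.SlotsNondegenerate₁₃ F N) :
    ∃ X : ∀ S : Scales θ.L, ExternalInputs S G,
      (∀ S : Scales θ.L, (X S).av = (X₀ S).av ∧ (X S).reg = (X₀ S).reg ∧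
        (S.g ^ 2 * S.ε₀ ≤ (min (gammaN08 𝔠) 1) ^ 2 → (∀ (k : ℕ) (h : Hist S.P k), Measurable ((X S).UkH k h)) ∧ InEdgeFaces₃ 𝔊 (regMin 𝔠) (X S))) ∧
      ∀ (𝔖 : ∀ (S : Scales θ.L) (k : ℕ), StepSeries S G ↥(lieC 𝔊) (nblkOf S 𝔠.lane.carrier k) k) (𝔄 : ∀ S : Scales θ.L, AlphaData 𝔊 𝔠 (X S) (𝔖 S))
        (coef : ∀ (S : Scales θ.L) (k : ℕ), Hist S.P (k + 1) → GaugeField S.P (k + 1) G → (j : ℕ) → TermSizes (oldGeom S.P k j)),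
        (∀ S : Scales θ.L, S.g ^ 2 * S.ε₀ ≤ (min (gammaN08 𝔠) 1) ^ 2 → RunDataRows 𝔊 𝔠 (X S) (𝔖 S) (𝔄 S) (sizesOf 𝔊 𝔠 (X S) (coef S))) →
        ∃ (θ' : Stage13Params F N) (h' : θ'.Provisos₁₃Core F N) (w : WorldP), (θ'.ZtUnity F N ∧ θ'.SlotsNondegenerate₁₃ F N) ∧ θ'.Admissible F N ∧
          IsRecordOfRecord₁₃CCoP F N (datumOfRecord₁₃CoP F N θ' h') w ∧ ∀ P : B12.RunParams, Dag.B10_main (leavesP w P) := by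
  obtain ⟨X, hX⟩ := N08AtRecord13LaneProfile.exists_inputs_faces₃_family_of_profile 𝔊 𝔠 X₀ hA W hW hWL T Bk hT
  exact ⟨X, hX, fun 𝔖 𝔄 coef hD =>
    exists_guarded_record₁₃CCoP_laneFamily_b10_main_of_data_faces₃ θ h hθ hG (𝔄 := 𝔄) coef hD fun S hS => ((hX S).2.2 hS).2⟩

end Profile

/-! ## §2b POINTED, OVER THE LANE-KEYED FOUR-LAYER STAGE-13 WORD `((((θ.rebindX (lane family at the selected inputs)).pinY Y₀).pinZ Z₀).pinW W₀).toStage5₁₃CoP` — the `b10` line of a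
four-pin pointed assembler that takes N08 from the (α) programme, faces DISCHARGED (provisos-free; `…LaneFamily` §2b `b10_main_of_up_rebindX_towerRuns_pin3` BY NAME) -/

section Pin3Profile
variable {𝔊 : GroupModel G}

/-- **★ POINTED CLOSER OVER THE LANE-KEYED FOUR-LAYER WORD, from profiles (b11‴) and the DATA schema at the selected inputs**: inputs `X` as in §1 EXIST such that, for every
`𝔖 ∕ 𝔄 ∕ coef` with DATA on the N08 window, at EVERY world bound over `((((θ.rebindX (lane family at X, 𝔖)).pinY Y₀).pinZ Z₀).pinW W₀).toStage5₁₃CoP` (any outer pins), `Dag.B10_main`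
holds at every run — no provisos, no record predicate: the `h`-line a lane-keyed four-pin pointed Stage-13 assembler consumes for N08. [cite: Balaban1985UV3, Thm 1 p.257 (compact reading) + Thm 2 p.272 + (42) p.266; Balaban1985Variational, Thm 1 (8) p.279; Balaban1989LargeFieldI, (0.2) p.176 (bookkeeping: the outer pins)] -/
theorem exists_inputs_b10_main_pin3_of_profile (θ : Stage13Params F N) {𝔠 : AlphaConsts θ.L 𝔊.N}
    (X₀ : ∀ S : Scales θ.L, ExternalInputs S G) {A : ∀ S : Scales θ.L, GaugeField S.P 0 G → ℝ}
    (hA : letI := rhoTopology 𝔊; ∀ S : Scales θ.L, Continuous (A S)) (W : ∀ (S : Scales θ.L) (k : ℕ), Hist S.P k → GaugeField S.P 0 G)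
    (hW : ∀ S : Scales θ.L, S.g ^ 2 * S.ε₀ ≤ (min (gammaN08 𝔠) 1) ^ 2 → ∀ k, k ≤ S.K → ∀ (h : Hist S.P k),
      Hist.Admissible (regMin 𝔠).lane.carrier.M₁ (rcolOf S (regMin 𝔠).lane.carrier) k h → W S k h ∈ regClassC 𝔊 (regMin 𝔠) k h ∩ argClassC 𝔊 k)
    (hWL : ∀ S : Scales θ.L, S.g ^ 2 * S.ε₀ ≤ (min (gammaN08 𝔠) 1) ^ 2 → ∀ (k : ℕ) (h : Hist S.P k),
      HLarge S (regMin 𝔠).lane.carrier.b₀ (regMin 𝔠).lane.carrier.p₀ h (fun j => avgIter θ.L (liftCfg 𝔊 (W S k h)) j))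
    (T : ∀ (S : Scales θ.L) (k : ℕ), GaugeField S.P 0 G → GaugeField S.P k G) (Bk : ∀ (S : Scales θ.L) (k : ℕ), Hist S.P k → Set (PBond S.P k))
    (hT : letI := rhoTopology 𝔊; ∀ (S : Scales θ.L) (k : ℕ) (h : Hist S.P k), ContinuousOn (T S k) (regClass 𝔊 (regMin 𝔠) k h)) :
    ∃ X : ∀ S : Scales θ.L, ExternalInputs S G,
      (∀ S : Scales θ.L, (X S).av = (X₀ S).av ∧ (X S).reg = (X₀ S).reg ∧
        (S.g ^ 2 * S.ε₀ ≤ (min (gammaN08 𝔠) 1) ^ 2 → (∀ (k : ℕ) (h : Hist S.P k), Measurable ((X S).UkH k h)) ∧ InEdgeFaces₃ 𝔊 (regMin 𝔠) (X S))) ∧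
      ∀ (𝔖 : ∀ (S : Scales θ.L) (k : ℕ), StepSeries S G ↥(lieC 𝔊) (nblkOf S 𝔠.lane.carrier k) k) (𝔄 : ∀ S : Scales θ.L, AlphaData 𝔊 𝔠 (X S) (𝔖 S))
        (coef : ∀ (S : Scales θ.L) (k : ℕ), Hist S.P (k + 1) → GaugeField S.P (k + 1) G → (j : ℕ) → TermSizes (oldGeom S.P k j)),
        (∀ S : Scales θ.L, S.g ^ 2 * S.ε₀ ≤ (min (gammaN08 𝔠) 1) ^ 2 → RunDataRows 𝔊 𝔠 (X S) (𝔖 S) (𝔄 S) (sizesOf 𝔊 𝔠 (X S) (coef S))) →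
        ∀ (Y₀ : PrintedCarriers9X) (Z₀ : PrintedCarriers11) (W₀ : B12.RunParams → PrintedCarriers15) {w : WorldP},
          (∀ P, w.up P = upOfRecord₅C F N
            (((((θ.rebindX F N fun P => (θ.res.X P).withTowerRuns10
              fun S : ScalesLE θ.L ((min (gammaN08 𝔠) 1) ^ 2) => towerOf 𝔠.lane (X S.1) (𝔖 S.1)).pinY F N Y₀).pinZ F N Z₀).pinW F N W₀).toStage5₁₃CoP F N) P) →
          ∀ P : B12.RunParams, Dag.B10_main (leavesP w P) := by
  obtain ⟨X, hX⟩ := N08AtRecord13LaneProfile.exists_inputs_faces₃_family_of_profile 𝔊 𝔠 X₀ hA W hW hWL T Bk hT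
  exact ⟨X, hX, fun 𝔖 𝔄 coef hD Y₀ Z₀ W₀ w hup =>
    b10_main_of_up_rebindX_towerRuns_pin3 (fun P => θ.res.X P) _ Y₀ Z₀ W₀ θ hup
      (N08AtRecord13LaneFamily.b10Compact_laneFamily_of_data_faces₃ θ (𝔄 := 𝔄) coef hD fun S hS => ((hX S).2.2 hS).2)⟩

end Pin3Profile

/-! ## §3 STANDARD AVERAGING: N08 AT THE LANE-RE-BOUND ₁₃CCoP RECORD FROM A `RunAlpha` FAMILY, AND FROM PROFILES (b11‴) + DATA with the Wilson action as objective and the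
iterated standard averaging on top (no `A ∕ T ∕ hT`) -/

section Std
variable {𝔊 : GroupModel G}

/-- **POINTED: a ₁₃CCoP record of `datumOfRecord₁₃CoP F N θ h` bound over the lane-re-bound Stage-13 view, carrying N08 at every run, from a `RunAlpha` family on the N08 window**
(any window `γw`, block size `θ.L`; `…LaneFamily.exists_world₁₃CCoP_rebindX_towerRuns_b10_main`). [cite: Balaban1985UV3, Thm 1 p.257 (compact reading) + Thm 2 p.272; Balaban1989LargeFieldII, Thm 1 + (0.1) pp.355–356 (bookkeeping)] -/
theorem exists_world₁₃CCoP_laneFamily_b10_main_of_runAlpha {θ : Stage13Params F N} (h : θ.Provisos₁₃Core F N) (hθ : θ.Admissible F N)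
    {𝔠 : AlphaConsts θ.L 𝔊.N} {X : ∀ S : Scales θ.L, ExternalInputs S G}
    {𝔖 : ∀ (S : Scales θ.L) (k : ℕ), StepSeries S G ↥(lieC 𝔊) (nblkOf S 𝔠.lane.carrier k) k} {𝔄 : ∀ S : Scales θ.L, AlphaData 𝔊 𝔠 (X S) (𝔖 S)}
    (hα : ∀ S : Scales θ.L, S.g ^ 2 * S.ε₀ ≤ (min (gammaN08 𝔠) 1) ^ 2 → RunAlpha 𝔊 𝔠 (X S) (𝔖 S) (𝔄 S)) {γw : ℝ} (hγw : 0 < γw ∧ γw ≤ θ.γ) :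
    ∃ w : WorldP, IsRecordOfRecord₁₃CCoP F N (datumOfRecord₁₃CoP F N θ h) w ∧ w.γ = γw ∧ w.L = (θ.L : ℝ) ∧
      (∀ P, w.up P = upOfRecord₅C F N ((θ.rebindX F N fun P => (θ.res.X P).withTowerRuns10
        fun S : ScalesLE θ.L ((min (gammaN08 𝔠) 1) ^ 2) => towerOf 𝔠.lane (X S.1) (𝔖 S.1)).toStage5₁₃CoP F N) P) ∧
      ∀ P : B12.RunParams, Dag.B10_main (leavesP w P) :=
  exists_world₁₃CCoP_rebindX_towerRuns_b10_main _ _ h hθ hγw (N08AtRecord13LaneProfile.b10Compact_laneFamily_of_runAlpha θ hα)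

/-- **N08's conjunct shape of `NodesAtSomeRecord13`, witnessed AT `θ`, from a `RunAlpha` family on the N08 window** (plus provisos, admissibility, guard).
[cite: Balaban1985UV3, Thm 1 p.257 (compact reading) + Thm 2 p.272; Balaban1989LargeFieldII, Thm 1 + (0.1) pp.355–356; Balaban1988Convergent, (3.16)–(3.22) pp.268–269 (bookkeeping)] -/
theorem exists_guarded_record₁₃CCoP_laneFamily_b10_main_of_runAlpha {θ : Stage13Params F N} (h : θ.Provisos₁₃Core F N) (hθ : θ.Admissible F N)
    (hG : θ.ZtUnity F N ∧ θ.SlotsNondegenerate₁₃ F N) {𝔠 : AlphaConsts θ.L 𝔊.N} {X : ∀ S : Scales θ.L, ExternalInputs S G}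
    {𝔖 : ∀ (S : Scales θ.L) (k : ℕ), StepSeries S G ↥(lieC 𝔊) (nblkOf S 𝔠.lane.carrier k) k} {𝔄 : ∀ S : Scales θ.L, AlphaData 𝔊 𝔠 (X S) (𝔖 S)}
    (hα : ∀ S : Scales θ.L, S.g ^ 2 * S.ε₀ ≤ (min (gammaN08 𝔠) 1) ^ 2 → RunAlpha 𝔊 𝔠 (X S) (𝔖 S) (𝔄 S)) :
    ∃ (θ' : Stage13Params F N) (h' : θ'.Provisos₁₃Core F N) (w : WorldP), (θ'.ZtUnity F N ∧ θ'.SlotsNondegenerate₁₃ F N) ∧ θ'.Admissible F N ∧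
      IsRecordOfRecord₁₃CCoP F N (datumOfRecord₁₃CoP F N θ' h') w ∧ ∀ P : B12.RunParams, Dag.B10_main (leavesP w P) :=
  exists_guarded_record₁₃CCoP_b10_main_of_towerRuns _ _ h hθ hG (N08AtRecord13LaneProfile.b10Compact_laneFamily_of_runAlpha θ hα)

variable (θ : Stage13Params F N) (h : θ.Provisos₁₃Core F N) (hθ : θ.Admissible F N) {𝔠 : AlphaConsts θ.L 𝔊.N}
  (X₀ : ∀ S : Scales θ.L, ExternalInputs S G) (hstd : ∀ S : Scales θ.L, (X₀ S).av = AveragingRT.stdAvg S.P G) (w : ℝ)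
  (W : ∀ (S : Scales θ.L) (k : ℕ), Hist S.P k → GaugeField S.P 0 G)
  (hW : ∀ S : Scales θ.L, S.g ^ 2 * S.ε₀ ≤ (min (gammaN08 𝔠) 1) ^ 2 → ∀ k, k ≤ S.K → ∀ (h : Hist S.P k),
    Hist.Admissible (regMin 𝔠).lane.carrier.M₁ (rcolOf S (regMin 𝔠).lane.carrier) k h → W S k h ∈ regClassC 𝔊 (regMin 𝔠) k h ∩ argClassC 𝔊 k)
  (hWL : ∀ S : Scales θ.L, S.g ^ 2 * S.ε₀ ≤ (min (gammaN08 𝔠) 1) ^ 2 → ∀ (k : ℕ) (h : Hist S.P k),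
    HLarge S (regMin 𝔠).lane.carrier.b₀ (regMin 𝔠).lane.carrier.p₀ h (fun j => avgIter θ.L (liftCfg 𝔊 (W S k h)) j))
  (Bk : ∀ (S : Scales θ.L) (k : ℕ), Hist S.P k → Set (PBond S.P k))

include h hθ hstd w hW hWL Bk

/-- **★ POINTED, STANDARD AVERAGING: a ₁₃CCoP record of `datumOfRecord₁₃CoP F N θ h` bound over the lane-re-bound Stage-13 view at the selected inputs, carrying N08 at every run,
from profiles (b11‴) and the DATA schema at the selected inputs** — objective the Wilson action of weight `w`, top map the iterated standard averaging (`X₀ S` standard).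
[cite: Balaban1985UV3, Thm 1 p.257 (compact reading) + Thm 2 p.272 + (41)–(42) p.266; Balaban1985Variational, Thm 1 (8) p.279; Balaban1989LargeFieldII, Thm 1 + (0.1) pp.355–356 (bookkeeping)] -/
theorem exists_world₁₃CCoP_laneFamily_b10_main_of_profile_std {γw : ℝ} (hγw : 0 < γw ∧ γw ≤ θ.γ) :
    ∃ X : ∀ S : Scales θ.L, ExternalInputs S G,
      (∀ S : Scales θ.L, (X S).av = (X₀ S).av ∧ (X S).reg = (X₀ S).reg ∧
        (S.g ^ 2 * S.ε₀ ≤ (min (gammaN08 𝔠) 1) ^ 2 → (∀ (k : ℕ) (h : Hist S.P k), Measurable ((X S).UkH k h)) ∧ InEdgeFaces₃ 𝔊 (regMin 𝔠) (X S))) ∧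
      ∀ (𝔖 : ∀ (S : Scales θ.L) (k : ℕ), StepSeries S G ↥(lieC 𝔊) (nblkOf S 𝔠.lane.carrier k) k) (𝔄 : ∀ S : Scales θ.L, AlphaData 𝔊 𝔠 (X S) (𝔖 S))
        (coef : ∀ (S : Scales θ.L) (k : ℕ), Hist S.P (k + 1) → GaugeField S.P (k + 1) G → (j : ℕ) → TermSizes (oldGeom S.P k j)),
        (∀ S : Scales θ.L, S.g ^ 2 * S.ε₀ ≤ (min (gammaN08 𝔠) 1) ^ 2 → RunDataRows 𝔊 𝔠 (X S) (𝔖 S) (𝔄 S) (sizesOf 𝔊 𝔠 (X S) (coef S))) →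
        ∃ w : WorldP, IsRecordOfRecord₁₃CCoP F N (datumOfRecord₁₃CoP F N θ h) w ∧ w.γ = γw ∧ w.L = (θ.L : ℝ) ∧
          (∀ P, w.up P = upOfRecord₅C F N ((θ.rebindX F N fun P => (θ.res.X P).withTowerRuns10
            fun S : ScalesLE θ.L ((min (gammaN08 𝔠) 1) ^ 2) => towerOf 𝔠.lane (X S.1) (𝔖 S.1)).toStage5₁₃CoP F N) P) ∧
          ∀ P : B12.RunParams, Dag.B10_main (leavesP w P) := by
  obtain ⟨X, hX⟩ := N08AtRecord13LaneProfile.exists_inputs_runAlpha_family_of_profile_std 𝔊 𝔠 X₀ hstd w W hW hWL Bk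
  exact ⟨X, fun S => ⟨(hX S).1, (hX S).2.1, fun hS => ⟨((hX S).2.2 hS).1, ((hX S).2.2 hS).2.1⟩⟩, fun 𝔖 𝔄 coef hD =>
    exists_world₁₃CCoP_laneFamily_b10_main_of_runAlpha h hθ (𝔄 := 𝔄) (fun S hS => ((hX S).2.2 hS).2.2 (𝔖 S) (𝔄 S) (coef S) (hD S hS)) hγw⟩

/-- **★ N08's CONJUNCT SHAPE OF `NodesAtSomeRecord13`, WITNESSED AT `θ`, STANDARD AVERAGING, from profiles (b11‴) and the DATA schema at the selected inputs** (plus provisos,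
admissibility, guard). [cite: Balaban1985UV3, Thm 1 p.257 (compact reading) + Thm 2 p.272 + (41)–(42) p.266; Balaban1985Variational, Thm 1 (8) p.279; Balaban1989LargeFieldII, Thm 1 + (0.1) pp.355–356; Balaban1988Convergent, (3.16)–(3.22) pp.268–269 (bookkeeping)] -/
theorem exists_guarded_record₁₃CCoP_laneFamily_b10_main_of_profile_std (hG : θ.ZtUnity F N ∧ θ.SlotsNondegenerate₁₃ F N) :
    ∃ X : ∀ S : Scales θ.L, ExternalInputs S G,
      (∀ S : Scales θ.L, (X S).av = (X₀ S).av ∧ (X S).reg = (X₀ S).reg ∧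
        (S.g ^ 2 * S.ε₀ ≤ (min (gammaN08 𝔠) 1) ^ 2 → (∀ (k : ℕ) (h : Hist S.P k), Measurable ((X S).UkH k h)) ∧ InEdgeFaces₃ 𝔊 (regMin 𝔠) (X S))) ∧
      ∀ (𝔖 : ∀ (S : Scales θ.L) (k : ℕ), StepSeries S G ↥(lieC 𝔊) (nblkOf S 𝔠.lane.carrier k) k) (𝔄 : ∀ S : Scales θ.L, AlphaData 𝔊 𝔠 (X S) (𝔖 S))
        (coef : ∀ (S : Scales θ.L) (k : ℕ), Hist S.P (k + 1) → GaugeField S.P (k + 1) G → (j : ℕ) → TermSizes (oldGeom S.P k j)),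
        (∀ S : Scales θ.L, S.g ^ 2 * S.ε₀ ≤ (min (gammaN08 𝔠) 1) ^ 2 → RunDataRows 𝔊 𝔠 (X S) (𝔖 S) (𝔄 S) (sizesOf 𝔊 𝔠 (X S) (coef S))) →
        ∃ (θ' : Stage13Params F N) (h' : θ'.Provisos₁₃Core F N) (w : WorldP), (θ'.ZtUnity F N ∧ θ'.SlotsNondegenerate₁₃ F N) ∧ θ'.Admissible F N ∧
          IsRecordOfRecord₁₃CCoP F N (datumOfRecord₁₃CoP F N θ' h') w ∧ ∀ P : B12.RunParams, Dag.B10_main (leavesP w P) := by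
  obtain ⟨X, hX⟩ := N08AtRecord13LaneProfile.exists_inputs_runAlpha_family_of_profile_std 𝔊 𝔠 X₀ hstd w W hW hWL Bk
  exact ⟨X, fun S => ⟨(hX S).1, (hX S).2.1, fun hS => ⟨((hX S).2.2 hS).1, ((hX S).2.2 hS).2.1⟩⟩, fun 𝔖 𝔄 coef hD =>
    exists_guarded_record₁₃CCoP_laneFamily_b10_main_of_runAlpha h hθ hG (𝔄 := 𝔄) fun S hS => ((hX S).2.2 hS).2.2 (𝔖 S) (𝔄 S) (coef S) (hD S hS)⟩

end Std

/-! ## §4 ON K0a's ALL-NUMERICS WITNESS FAMILY `θL F n ε₂₉ = theta13LiveOfNumerics F 2 n ε₂₉ …` (`N = 2`, block size `F.L` by `rfl`), PROVISOS OPAQUE `hP : θL.Provisos₁₃Core F 2` -/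

section Numerics
variable {𝔊 : GroupModel G}

/-- **★★ DATA ∧ FACES form, provisos opaque** (p498647 §4's `hP`-opaque form, Core key): from `n.Pos`, `0 < ε₂₉`,
`hP : θL.Provisos₁₃Core F 2` AT THE MEMBER and lane objects at block size `F.L` with «DATA ∧ three faces» on the N08 window ⟹ N08's conjunct of the ₁₃ nodes-∃ (guard and
admissibility at `θL` are K0a's theorems BY NAME). [cite: Balaban1985UV3, Thm 1 p.257 (compact reading) + Thm 2 p.272; Balaban1988Convergent, (3.16)–(3.22) pp.268–269; Balaban1987RG1, Thm 1 p.255 (bookkeeping)] -/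
theorem exists_guarded_record₁₃CCoP_laneFamily_b10_main_at_theta13LiveOfNumerics_of_data_faces₃ (F : T4Family) {n : Stage12Numerics} {ε₂₉ : ℝ} (hn : n.Pos) (hε' : 0 < ε₂₉)
    (hP : (theta13LiveOfNumerics F 2 n ε₂₉ (zeta316OfRecord F 2 n.ν n.τ9.M n.A₁) (RzOfRecord F 2) (ZtOfRecord F 2)).Provisos₁₃Core F 2)
    {𝔠 : AlphaConsts F.L 𝔊.N} {X : ∀ S : Scales F.L, ExternalInputs S G}
    {𝔖 : ∀ (S : Scales F.L) (k : ℕ), StepSeries S G ↥(lieC 𝔊) (nblkOf S 𝔠.lane.carrier k) k} {𝔄 : ∀ S : Scales F.L, AlphaData 𝔊 𝔠 (X S) (𝔖 S)}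
    (coef : ∀ (S : Scales F.L) (k : ℕ), Hist S.P (k + 1) → GaugeField S.P (k + 1) G → (j : ℕ) → TermSizes (oldGeom S.P k j))
    (hD : ∀ S : Scales F.L, S.g ^ 2 * S.ε₀ ≤ (min (gammaN08 𝔠) 1) ^ 2 → RunDataRows 𝔊 𝔠 (X S) (𝔖 S) (𝔄 S) (sizesOf 𝔊 𝔠 (X S) (coef S)))
    (hF : ∀ S : Scales F.L, S.g ^ 2 * S.ε₀ ≤ (min (gammaN08 𝔠) 1) ^ 2 → InEdgeFaces₃ 𝔊 (regMin 𝔠) (X S)) :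
    ∃ (θ : Stage13Params F 2) (h : θ.Provisos₁₃Core F 2) (w : WorldP), (θ.ZtUnity F 2 ∧ θ.SlotsNondegenerate₁₃ F 2) ∧ θ.Admissible F 2 ∧
      IsRecordOfRecord₁₃CCoP F 2 (datumOfRecord₁₃CoP F 2 θ h) w ∧ ∀ P : B12.RunParams, Dag.B10_main (leavesP w P) :=
  exists_guarded_record₁₃CCoP_laneFamily_b10_main_of_data_faces₃ _ hP (admissible_theta13LiveOfNumerics F 2 _ _ _ hn hε')
    ⟨ztUnity_theta13LiveOfNumerics F 2 n ε₂₉, slotsNondegenerate₁₃_theta13LiveOfNumerics_of_hasResiduals F 2 n ε₂₉⟩ (𝔄 := 𝔄) coef hD hF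

/-- **★★ PROFILE form, provisos opaque**: from `n.Pos`, `0 < ε₂₉`, `hP : θL.Provisos₁₃Core F 2`, and at block size `F.L` base inputs `X₀`, a continuous objective, profiles (b11‴) with
`h`-large averages, top maps continuous on [7]'s class and bonds on the N08 window ⟹ selected inputs `X` (faces a THEOREM) such that the DATA schema at `X` gives N08's conjunct of
the ₁₃ nodes-∃. [cite: Balaban1985UV3, Thm 1 p.257 (compact reading) + Thm 2 p.272 + (42) p.266; Balaban1985Variational, Thm 1 (8) p.279; Balaban1988Convergent, (3.16)–(3.22) pp.268–269 (bookkeeping)] -/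
theorem exists_guarded_record₁₃CCoP_laneFamily_b10_main_at_theta13LiveOfNumerics_of_profile (F : T4Family) {n : Stage12Numerics} {ε₂₉ : ℝ} (hn : n.Pos) (hε' : 0 < ε₂₉)
    (hP : (theta13LiveOfNumerics F 2 n ε₂₉ (zeta316OfRecord F 2 n.ν n.τ9.M n.A₁) (RzOfRecord F 2) (ZtOfRecord F 2)).Provisos₁₃Core F 2)
    {𝔠 : AlphaConsts F.L 𝔊.N}
    (X₀ : ∀ S : Scales F.L, ExternalInputs S G) {A : ∀ S : Scales F.L, GaugeField S.P 0 G → ℝ}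
    (hA : letI := rhoTopology 𝔊; ∀ S : Scales F.L, Continuous (A S)) (W : ∀ (S : Scales F.L) (k : ℕ), Hist S.P k → GaugeField S.P 0 G)
    (hW : ∀ S : Scales F.L, S.g ^ 2 * S.ε₀ ≤ (min (gammaN08 𝔠) 1) ^ 2 → ∀ k, k ≤ S.K → ∀ (h : Hist S.P k),
      Hist.Admissible (regMin 𝔠).lane.carrier.M₁ (rcolOf S (regMin 𝔠).lane.carrier) k h → W S k h ∈ regClassC 𝔊 (regMin 𝔠) k h ∩ argClassC 𝔊 k)
    (hWL : ∀ S : Scales F.L, S.g ^ 2 * S.ε₀ ≤ (min (gammaN08 𝔠) 1) ^ 2 → ∀ (k : ℕ) (h : Hist S.P k),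
      HLarge S (regMin 𝔠).lane.carrier.b₀ (regMin 𝔠).lane.carrier.p₀ h (fun j => avgIter F.L (liftCfg 𝔊 (W S k h)) j))
    (T : ∀ (S : Scales F.L) (k : ℕ), GaugeField S.P 0 G → GaugeField S.P k G) (Bk : ∀ (S : Scales F.L) (k : ℕ), Hist S.P k → Set (PBond S.P k))
    (hT : letI := rhoTopology 𝔊; ∀ (S : Scales F.L) (k : ℕ) (h : Hist S.P k), ContinuousOn (T S k) (regClass 𝔊 (regMin 𝔠) k h)) :
    ∃ X : ∀ S : Scales F.L, ExternalInputs S G,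
      (∀ S : Scales F.L, (X S).av = (X₀ S).av ∧ (X S).reg = (X₀ S).reg ∧
        (S.g ^ 2 * S.ε₀ ≤ (min (gammaN08 𝔠) 1) ^ 2 → (∀ (k : ℕ) (h : Hist S.P k), Measurable ((X S).UkH k h)) ∧ InEdgeFaces₃ 𝔊 (regMin 𝔠) (X S))) ∧
      ∀ (𝔖 : ∀ (S : Scales F.L) (k : ℕ), StepSeries S G ↥(lieC 𝔊) (nblkOf S 𝔠.lane.carrier k) k) (𝔄 : ∀ S : Scales F.L, AlphaData 𝔊 𝔠 (X S) (𝔖 S))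
        (coef : ∀ (S : Scales F.L) (k : ℕ), Hist S.P (k + 1) → GaugeField S.P (k + 1) G → (j : ℕ) → TermSizes (oldGeom S.P k j)),
        (∀ S : Scales F.L, S.g ^ 2 * S.ε₀ ≤ (min (gammaN08 𝔠) 1) ^ 2 → RunDataRows 𝔊 𝔠 (X S) (𝔖 S) (𝔄 S) (sizesOf 𝔊 𝔠 (X S) (coef S))) →
        ∃ (θ : Stage13Params F 2) (h : θ.Provisos₁₃Core F 2) (w : WorldP), (θ.ZtUnity F 2 ∧ θ.SlotsNondegenerate₁₃ F 2) ∧ θ.Admissible F 2 ∧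
          IsRecordOfRecord₁₃CCoP F 2 (datumOfRecord₁₃CoP F 2 θ h) w ∧ ∀ P : B12.RunParams, Dag.B10_main (leavesP w P) :=
  exists_guarded_record₁₃CCoP_laneFamily_b10_main_of_profile _ hP (admissible_theta13LiveOfNumerics F 2 _ _ _ hn hε') X₀ hA W hW hWL T Bk hT
    ⟨ztUnity_theta13LiveOfNumerics F 2 n ε₂₉, slotsNondegenerate₁₃_theta13LiveOfNumerics_of_hasResiduals F 2 n ε₂₉⟩

/-- **★★ PROFILE form, STANDARD AVERAGING, provisos opaque**: the same with the Wilson action of weight `w` as objective and the iterated standard averaging on top (`X₀ S`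
standard; no `A ∕ T ∕ hT`). [cite: Balaban1985UV3, Thm 1 p.257 (compact reading) + Thm 2 p.272 + (41)–(42) p.266; Balaban1985Variational, Thm 1 (8) p.279; Balaban1988Convergent, (3.16)–(3.22) pp.268–269 (bookkeeping)] -/
theorem exists_guarded_record₁₃CCoP_laneFamily_b10_main_at_theta13LiveOfNumerics_of_profile_std (F : T4Family) {n : Stage12Numerics} {ε₂₉ : ℝ} (hn : n.Pos) (hε' : 0 < ε₂₉)
    (hP : (theta13LiveOfNumerics F 2 n ε₂₉ (zeta316OfRecord F 2 n.ν n.τ9.M n.A₁) (RzOfRecord F 2) (ZtOfRecord F 2)).Provisos₁₃Core F 2)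
    {𝔠 : AlphaConsts F.L 𝔊.N}
    (X₀ : ∀ S : Scales F.L, ExternalInputs S G) (hstd : ∀ S : Scales F.L, (X₀ S).av = AveragingRT.stdAvg S.P G) (w : ℝ)
    (W : ∀ (S : Scales F.L) (k : ℕ), Hist S.P k → GaugeField S.P 0 G)
    (hW : ∀ S : Scales F.L, S.g ^ 2 * S.ε₀ ≤ (min (gammaN08 𝔠) 1) ^ 2 → ∀ k, k ≤ S.K → ∀ (h : Hist S.P k),
      Hist.Admissible (regMin 𝔠).lane.carrier.M₁ (rcolOf S (regMin 𝔠).lane.carrier) k h → W S k h ∈ regClassC 𝔊 (regMin 𝔠) k h ∩ argClassC 𝔊 k)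
    (hWL : ∀ S : Scales F.L, S.g ^ 2 * S.ε₀ ≤ (min (gammaN08 𝔠) 1) ^ 2 → ∀ (k : ℕ) (h : Hist S.P k),
      HLarge S (regMin 𝔠).lane.carrier.b₀ (regMin 𝔠).lane.carrier.p₀ h (fun j => avgIter F.L (liftCfg 𝔊 (W S k h)) j))
    (Bk : ∀ (S : Scales F.L) (k : ℕ), Hist S.P k → Set (PBond S.P k)) :
    ∃ X : ∀ S : Scales F.L, ExternalInputs S G,
      (∀ S : Scales F.L, (X S).av = (X₀ S).av ∧ (X S).reg = (X₀ S).reg ∧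
        (S.g ^ 2 * S.ε₀ ≤ (min (gammaN08 𝔠) 1) ^ 2 → (∀ (k : ℕ) (h : Hist S.P k), Measurable ((X S).UkH k h)) ∧ InEdgeFaces₃ 𝔊 (regMin 𝔠) (X S))) ∧
      ∀ (𝔖 : ∀ (S : Scales F.L) (k : ℕ), StepSeries S G ↥(lieC 𝔊) (nblkOf S 𝔠.lane.carrier k) k) (𝔄 : ∀ S : Scales F.L, AlphaData 𝔊 𝔠 (X S) (𝔖 S))
        (coef : ∀ (S : Scales F.L) (k : ℕ), Hist S.P (k + 1) → GaugeField S.P (k + 1) G → (j : ℕ) → TermSizes (oldGeom S.P k j)),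
        (∀ S : Scales F.L, S.g ^ 2 * S.ε₀ ≤ (min (gammaN08 𝔠) 1) ^ 2 → RunDataRows 𝔊 𝔠 (X S) (𝔖 S) (𝔄 S) (sizesOf 𝔊 𝔠 (X S) (coef S))) →
        ∃ (θ : Stage13Params F 2) (h : θ.Provisos₁₃Core F 2) (w : WorldP), (θ.ZtUnity F 2 ∧ θ.SlotsNondegenerate₁₃ F 2) ∧ θ.Admissible F 2 ∧
          IsRecordOfRecord₁₃CCoP F 2 (datumOfRecord₁₃CoP F 2 θ h) w ∧ ∀ P : B12.RunParams, Dag.B10_main (leavesP w P) :=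
  exists_guarded_record₁₃CCoP_laneFamily_b10_main_of_profile_std _ hP (admissible_theta13LiveOfNumerics F 2 _ _ _ hn hε') X₀ hstd w W hW hWL Bk
    ⟨ztUnity_theta13LiveOfNumerics F 2 n ε₂₉, slotsNondegenerate₁₃_theta13LiveOfNumerics_of_hasResiduals F 2 n ε₂₉⟩

end Numerics

end Summit.QuantumFields.YangMills.BalabanUVNodes.N08AtRecord13CoPLaneProfile

end
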